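import Literature.AlgebraicGeometry.Morphisms.GlueDataSeparated
import Literature.AlgebraicGeometry.Morphisms.GlueDataOfOpens
import HarnessLib

/-!
# Separatedness of a glued scheme from CLOSED RANGE of the graphs of the gluing relation

[Hartshorne1977] II Cor. 4.2: «`f : X → Y` is separated iff the image of the diagonal morphism is a closed subset»;
[GortzWedhorn2020] Def./Prop. 9.7 (iii) (graphs of morphisms to a separated scheme are closed immersions) and Prop. 9.15
(separatedness on an affine open covering).  For a scheme glued from `D : Scheme.GlueData` over a base `B`, ★
`Morphisms/GlueDataSeparated.glueData_isSeparated_desc` asks that every graph of the gluing relation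
`(f i j, t i j ≫ f j i) : V (i, j) ⟶ U i ×_B U j` be a CLOSED IMMERSION.  THIS FILE supplies the practical form a
quotient-by-slices argument delivers ([MumfordFogartyKirwan1994] Prop. 7.6: «the graph of the action is closed»):

* `isPreimmersion_of_comp_isPreimmersion` — if `g ≫ f` is a preimmersion (e.g. `g ≫ pr₁` an open immersion), so is `g`
  (NO hypothesis on `f`);  `isClosedImmersion_of_isClosed_range_of_comp` — … and if moreover the range of `g` is CLOSED,
  `g` is a closed immersion (Mathlib `IsClosedImmersion.of_isPreimmersion`);
* **`glueData_isSeparated_desc_of_isClosed_range`** — the glued structure morphism `q : D.glued ⟶ B` is separated as soon as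
  every graph `V (i, j) ⟶ U i ×_B U j` has CLOSED RANGE (its first component `f i j` is an open immersion), and the absolute
  form `glueData_isSeparated_of_isClosed_range`;
* §3 the same read on ★ `GlueDataOfOpens.OpensGlueDatum` (charts `U i`, opens `W i j`, transition maps `t i j : W i j ⟶ U j`):
  `OpensGlueDatum.isSeparated_desc` (closed-immersion form) and **`OpensGlueDatum.isSeparated_desc_of_isClosed_range`**
  (graph `{(x, t i j x)} ⊆ U i ×_B U j` with closed range).

Theorems only; no `sorry`, no instance, no named fact.  Cell hodgecm-mathlib, F-DAG leaf F-8 (8d) «separatedness of `A⁰` ⇐ the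
graph of the gluing relation is closed», sequel to ★ `GlueDataSeparated` (B-p14 (g16)).  HC_CM is proved only modulo the printed
citations until rung 0 closes; this file discharges none of them.

## References
* [Hartshorne1977] R. Hartshorne, *Algebraic Geometry* (1977), II §4 Corollary 4.2.
* [GortzWedhorn2020] U. Görtz, T. Wedhorn, *Algebraic Geometry I*, 2nd ed. (2020), Section (9.3) Definition 9.7, Proposition 9.15.
* [StacksProject] The Stacks Project, Tag 01KP (Lemma 26.21.7), Tag 01KK (Definition 26.21.3).
* [MumfordFogartyKirwan1994] D. Mumford, J. Fogarty, F. Kirwan, *Geometric Invariant Theory*, 3rd ed. (1994), Prop. 7.6.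
-/

noncomputable section

universe u

open CategoryTheory CategoryTheory.Limits AlgebraicGeometry TopologicalSpace Topology

namespace Literature.AlgebraicGeometry.Morphisms

/-! ### §1 Closed range and a preimmersive composite ⇒ closed immersion -/

/-- If `g ≫ f` is a preimmersion (an embedding, surjective on stalks), so is `g` — with NO hypothesis on `f`
(topology: `IsEmbedding.of_comp`; stalks: a composite surjection has surjective outer factor).  Typical use:
`g ≫ pr₁` an open immersion. [cite: StacksProject, Tag 01KK] [cite: GortzWedhorn2020, Section (9.3) Definition 9.7] -/
theorem isPreimmersion_of_comp_isPreimmersion {W P X : Scheme.{u}} (g : W ⟶ P) (f : P ⟶ X)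
    [IsPreimmersion (g ≫ f)] : IsPreimmersion g where
  isEmbedding := by
    have h := (g ≫ f).isEmbedding
    have e : ⇑(g ≫ f) = ⇑f ∘ ⇑g := funext fun x => Scheme.Hom.comp_apply g f x
    rw [e] at h
    exact IsEmbedding.of_comp g.continuous f.continuous h
  stalkMap_surjective x := by
    have h := (g ≫ f).stalkMap_surjective x
    rw [Scheme.Hom.stalkMap_comp] at h
    exact Function.Surjective.of_comp h

/-- **Closed range ⇒ closed immersion, for a morphism with a preimmersive composite** ([Hartshorne1977] II Cor. 4.2
pattern): if `g ≫ f` is a preimmersion and the range of `g` is CLOSED, then `g` is a closed immersion (Mathlib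
`IsClosedImmersion.of_isPreimmersion`). [cite: Hartshorne1977, II §4 Corollary 4.2] [cite: StacksProject, Tag 01KK] -/
theorem isClosedImmersion_of_isClosed_range_of_comp {W P X : Scheme.{u}} (g : W ⟶ P) (f : P ⟶ X)
    [IsPreimmersion (g ≫ f)] (hc : IsClosed (Set.range g)) : IsClosedImmersion g :=
  haveI := isPreimmersion_of_comp_isPreimmersion g f
  IsClosedImmersion.of_isPreimmersion g hc

/-! ### §2 Glue data: closed range of the graphs -/

section GlueData

variable (D : Scheme.GlueData.{u}) {B : Scheme.{u}}

/-- **Separatedness of a glued scheme from closed graphs** ([Hartshorne1977] II Cor. 4.2; [GortzWedhorn2020] Prop. 9.15;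
[MumfordFogartyKirwan1994] Prop. 7.6): if `q : D.glued ⟶ B` is glued from `p i : U i ⟶ B` and every graph of the gluing
relation `(f i j, t i j ≫ f j i) : V (i, j) ⟶ U i ×_B U j` has CLOSED RANGE, then `q` is separated — each graph followed
by `pr₁` is the open immersion `f i j`, so it is a preimmersion with closed range, i.e. a closed immersion (§1), and ★
`glueData_isSeparated_desc` applies. [cite: Hartshorne1977, II §4 Corollary 4.2]
[cite: GortzWedhorn2020, Section (9.3) Proposition 9.15 (proof)] [cite: StacksProject, Tag 01KP] -/
theorem glueData_isSeparated_desc_of_isClosed_range (p : ∀ i, D.U i ⟶ B)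
    (hp : ∀ i j, D.f i j ≫ p i = D.t i j ≫ D.f j i ≫ p j) (q : D.glued ⟶ B) (hq : ∀ i, D.ι i ≫ q = p i)
    (h : ∀ i j, IsClosed (Set.range
      (pullback.lift (D.f i j) (D.t i j ≫ D.f j i) (by rw [hp, Category.assoc]) : D.V (i, j) ⟶ pullback (p i) (p j)))) :
    IsSeparated q := by
  refine glueData_isSeparated_desc D p hp q hq fun i j => ?_
  haveI : IsPreimmersion (pullback.lift (D.f i j) (D.t i j ≫ D.f j i) (by rw [hp, Category.assoc]) ≫
      pullback.fst (p i) (p j)) := by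
    rw [pullback.lift_fst]
    infer_instance
  exact isClosedImmersion_of_isClosed_range_of_comp _ (pullback.fst (p i) (p j)) (h i j)

/-- **Absolute form**: if every graph `V (i, j) ⟶ U i × U j` (fibre product of the terminal morphisms) has closed range,
the glued scheme is separated. [cite: Hartshorne1977, II §4 Corollary 4.2] [cite: GortzWedhorn2020, Section (9.3) Proposition 9.15 (proof)] -/
theorem glueData_isSeparated_of_isClosed_range
    (h : ∀ i j, IsClosed (Set.range
      (pullback.lift (D.f i j) (D.t i j ≫ D.f j i) (by simp only [terminal.comp_from]) :
        D.V (i, j) ⟶ pullback (terminal.from (D.U i)) (terminal.from (D.U j))))) :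
    D.glued.IsSeparated :=
  ⟨glueData_isSeparated_desc_of_isClosed_range D (fun i => terminal.from (D.U i))
    (fun i j => by simp only [terminal.comp_from]) (terminal.from D.glued) (fun i => terminal.comp_from _) h⟩

end GlueData

/-! ### §3 Glue data from open subschemes -/

namespace OpensGlueDatum

variable (𝒟 : OpensGlueDatum.{u}) {B : Scheme.{u}} (p : ∀ i, 𝒟.U i ⟶ B)

/-- For an `OpensGlueDatum` the compatibility of chart structure maps reads `(W i j).ι ≫ p i = t i j ≫ p j`.
[cite: GortzWedhorn2020, Section (3.5) Proposition 3.10] -/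
theorem glueData_f_comp_eq (hp : ∀ i j, (𝒟.W i j).ι ≫ p i = 𝒟.t i j ≫ p j) (i j : 𝒟.J) :
    𝒟.glueData.f i j ≫ p i = 𝒟.glueData.t i j ≫ 𝒟.glueData.f j i ≫ p j := by
  rw [glueData_f, glueData_f, glueData_t, ← Category.assoc, tLift_ι]
  exact hp i j

/-- **Separatedness of a scheme glued from open subschemes** ([GortzWedhorn2020] Prop. 9.15): with `q` glued from
`p i : U i ⟶ B` (`(W i j).ι ≫ p i = t i j ≫ p j`), `q` is separated if every graph `((W i j).ι, t i j) : W i j ⟶ U i ×_B U j`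
of a transition map is a closed immersion (★ `glueData_isSeparated_desc` on `𝒟.glueData`).
[cite: GortzWedhorn2020, Section (9.3) Proposition 9.15 (proof)] [cite: StacksProject, Tag 01KP] -/
theorem isSeparated_desc (hp : ∀ i j, (𝒟.W i j).ι ≫ p i = 𝒟.t i j ≫ p j) (q : 𝒟.glueData.glued ⟶ B)
    (hq : ∀ i, 𝒟.glueData.ι i ≫ q = p i)
    (h : ∀ i j, IsClosedImmersion
      (pullback.lift (𝒟.W i j).ι (𝒟.t i j) (hp i j) : (𝒟.W i j : Scheme.{u}) ⟶ pullback (p i) (p j))) :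
    IsSeparated q := by
  refine glueData_isSeparated_desc 𝒟.glueData p (glueData_f_comp_eq 𝒟 p hp) q hq fun i j => ?_
  have e : (pullback.lift (𝒟.glueData.f i j) (𝒟.glueData.t i j ≫ 𝒟.glueData.f j i)
      (by rw [glueData_f_comp_eq 𝒟 p hp, Category.assoc]) : 𝒟.glueData.V (i, j) ⟶ pullback (p i) (p j)) =
      pullback.lift (𝒟.W i j).ι (𝒟.t i j) (hp i j) := by
    apply pullback.hom_ext
    · rw [pullback.lift_fst, pullback.lift_fst, glueData_f]
    · rw [pullback.lift_snd, pullback.lift_snd, glueData_t, glueData_f, tLift_ι]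
  rw [e]
  exact h i j

/-- **Practical form** (leaf F-8 (8d); [Hartshorne1977] II Cor. 4.2): with `q` glued from `p i : U i ⟶ B`, if every graph
`{(x, t i j x)} : W i j ⟶ U i ×_B U j` has CLOSED RANGE, then `q` is separated.
[cite: Hartshorne1977, II §4 Corollary 4.2] [cite: GortzWedhorn2020, Section (9.3) Proposition 9.15 (proof)] -/
theorem isSeparated_desc_of_isClosed_range (hp : ∀ i j, (𝒟.W i j).ι ≫ p i = 𝒟.t i j ≫ p j)
    (q : 𝒟.glueData.glued ⟶ B) (hq : ∀ i, 𝒟.glueData.ι i ≫ q = p i)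
    (h : ∀ i j, IsClosed (Set.range
      (pullback.lift (𝒟.W i j).ι (𝒟.t i j) (hp i j) : (𝒟.W i j : Scheme.{u}) ⟶ pullback (p i) (p j)))) :
    IsSeparated q := by
  refine isSeparated_desc 𝒟 p hp q hq fun i j => ?_
  haveI : IsPreimmersion (pullback.lift (𝒟.W i j).ι (𝒟.t i j) (hp i j) ≫ pullback.fst (p i) (p j)) := by
    rw [pullback.lift_fst]
    infer_instance
  exact isClosedImmersion_of_isClosed_range_of_comp _ (pullback.fst (p i) (p j)) (h i j)

end OpensGlueDatum

end Literature.AlgebraicGeometry.Morphisms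

end
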